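import Summits.ABC.IUTFork.BrobergCondP6Certificate
import Literature.IUT.LogVolume.Corollary22Legendre
import Literature.NumberTheory.DiophantineGeometry.GenEllGaloisImageTwist
import Literature.NumberTheory.DiophantineGeometry.GenEllGaloisImageUp
import Literature.NumberTheory.DiophantineGeometry.GenEllImageModLContainsSL2
import Literature.NumberTheory.DiophantineGeometry.LocalReductionHasMultiplicativeReductionAtProofs
import Literature.NumberTheory.DiophantineGeometry.MinimalDiscriminantNormProofs
import Literature.NumberTheory.EllipticCurves.LegendreFormGoodModelProofs
import Mathlib.LinearAlgebra.FreeModule.IdealQuotient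
import HarnessLib

/-!
# (P6) at Broberg's quadratic point: the Galois image on `E_λ[7]` and `E_λ[11]` over `ℚ(√7)` contains `SL₂` — IN KERNEL,
# by a Frobenius certificate at the prime `(3 + 2√7)` of norm `19`

PROOF-ONLY file (0 definitions, 0 `Prop` facts, no instance, no notation) of the abc-iut cell (D-0079 RESCUE sub-cell R-W,
W1 ROW DECISIONS seat abc-iut-W-row-2, gen 5); classical arithmetic of ONE elliptic curve over `ℚ(√7)`; TAKES NO SIDE on
[IUTchIII] Cor. 3.12 or on any author. It removes the hypothesis `Cor22.CondP6 Broberg.point l` (`l = 7, 11`) from gen 4's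
`Broberg.nonempty_thetaVolumeDatumAt_seven/eleven_of_condP6` (`BrobergAdmissible`), so that the `∀ T : ThetaVolumeDatumAt
Broberg.point 7 / 11` theorems of rows 9/10 of HOME/plan/rescue/R-W/OPEN-10.md (`WRow.licence_broberg_seven/eleven_unconditional`)
quantify over a NON-EMPTY type UNCONDITIONALLY — parity with the rational rows after «C:P6-KERNEL-N3».

(P6) ([IUTchIV] Cor. 2.2 (ii) proof, p. 46; = [IUTchI] Def. 3.1 (c)): "the image of `Gal(F̄/F) → GL₂(𝔽_l)` on the `l`-torsion of
`E_F` contains `SL₂(𝔽_l)`", `E : y² = x(x−1)(x−λ)`, `F` any theta-field `F_tpd(√−1, E[15])`, here `F_tpd = ℚ(√7)`,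
`λ = (8−3√7)²(5−2√7)/(4−3√7)⁴ = a/c` with `a = −ε′³ϖ₃ = 1307 − 494√7`, `c = ϖ₄₇⁴ = 10273 − 3792√7` (`BrobergPoint.lam_eq`):
* §1–§2 = the prequel `BrobergCondP6Certificate.lean`: the `𝓞_K`-integral model `E₁ = [0, −(c²+ac), 0, ac³, 0]` and the Frobenius
  certificate at `𝔮 = (3 + 2√7)` (`N𝔮 = 19`, `a_𝔮 = −4`): `E₁[7]`, `E₁[11]` irreducible over `ℚ(√7)` (`hasIrreducibleModPGaloisRep_seven/eleven`);
* §3 the place `𝔭₃ = (2+√7)`: `𝓞_K/𝔭₃ ≅ 𝔽₃` (`√7 ↦ 1`), `E₁ mod 𝔭₃ = [0, 2, 0, 0, 0]` (a node), `c₄(E₁) ∉ 𝔭₃`, `ord_{𝔭₃} Δ(E₁) = 2`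
  (`Δ = 16a²b²c⁸`, `b = c − a = ε²ϖ₂³ϖ₃′¹²`) ⇒ `E₁/ℚ(√7)` MULTIPLICATIVE at `𝔭₃` with `ord_{𝔭₃}(Δ_min) = 2`
  (Silverman VII.5.1(b), VII.1.1; tree `hasMultiplicativeReductionAt_of_valuation_c₄_eq_one`, `valuation_Δ_eq_of_isMinimalAt_holds`);
* §4 **`Im(Γ_{ℚ(√7)} → Aut E₁[l]) ⊇ SL₂(𝔽_l)`** for `l = 7, 11`: irreducible + the Tate-curve transvection at `𝔭₃` (`l ∤ 3`, `l ∤ 2`)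
  ([GenEll] Lem. 3.1 (iii), tree `EllPoint.imageModLContainsSL2_of_not_admitsLCyclic_of_hasMultiplicativeReductionAt`), moved to the
  Legendre model by `EllPoint.imageModLContainsSL2_of_variableChange_eq`, and UP to every theta-field (`IsThetaField.isGalois`,
  `finrank_dvd : [F : ℚ(√7)] ∣ 46080 = 2¹⁰3²5`) by `EllPoint.imageModLContainsSL2_map_of_isGalois_of_not_dvd`:
  **`Broberg.condP6_seven : Cor22.CondP6 Broberg.point 7`**, **`Broberg.condP6_eleven`**, and the UNCONDITIONAL
  **`Broberg.nonempty_thetaVolumeDatumAt_seven : Nonempty (Cor22.ThetaVolumeDatumAt Broberg.point 7)`** / `…_eleven`.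

HONEST SCOPE: a classical Galois-image statement about one elliptic curve over `ℚ(√7)` (Serre/Mazur/Silverman, undisputed) and
one application of a proved route theorem (`ThetaPartII.stub_thetaData` via `BrobergAdmissible`); nothing about Θ-data or any
disputed step; Szpiro-badness and the truth of any `S_H` NOT claimed; inhabited-as-typed ≠ true-in-print; typed ≠ proved; no abc claim.
Desk numbers (HOME/abc-iut-W-row-2 gen 5, work/cert.py): `N(Δ(E₁)) = 2¹⁴3²⁶47³²`; `ā = 15`, `c̄ = 1` in `𝔽₁₉`.
[cite: Mochizuki2012, IUTchIV Cor. 2.2 (ii) proof (P6) p. 46; IUTchI Def. 3.1 (c)] [cite: Mazur1978, §6 Prop. 6.3 (1) p. 153]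
[cite: MochizukiGenEll2010, Lem. 3.1 (iii) p. 14] [cite: SilvermanAEC2009, VII.1 Rem. 1.1, VII.5 Prop. 5.1(b), III.1 Table 3.1]
[cite: NeukirchANT1999, Ch. I §8] [claim: Mochizuki2012, status: disputed] for every IUT quotation.
-/

noncomputable section

open scoped Classical NumberField

open NumberField IsDedekindDomain IsDedekindDomain.HeightOneSpectrum WeierstrassCurve QuadraticAlgebra

namespace Summit.ABC.IUTFork.Broberg

open Sqrt7 Literature.IUT.LogVolume Literature.NumberTheory.NumberFields Literature.NumberTheory.EllipticCurves
  Literature.NumberTheory.DiophantineGeometry.GenEll Literature.NumberTheory.DiophantineGeometry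

/-! ## §3 The place `𝔭₃ = (2 + √7)`: multiplicative reduction of `E₁` with `ord_{𝔭₃}(Δ_min) = 2` -/

/-- **`𝓞 K / 𝔭₃ ≅ 𝔽₃` with `√7 ↦ 1`** (`2 + √7 ∈ 𝔭₃`). [folklore] -/
theorem exists_ringEquiv_zmod_three :
    ∃ e : 𝓞 K ⧸ 𝔭₃.asIdeal ≃+* ZMod 3, e (Ideal.Quotient.mk 𝔭₃.asIdeal sqrt7Int) = 1 := by
  haveI : Finite (𝓞 K ⧸ 𝔭₃.asIdeal) := Ideal.finiteQuotientOfFreeOfNeBot 𝔭₃.asIdeal 𝔭₃.ne_bot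
  letI : Fintype (𝓞 K ⧸ 𝔭₃.asIdeal) := Fintype.ofFinite _
  have hcard : Fintype.card (𝓞 K ⧸ 𝔭₃.asIdeal) = 3 := by
    rw [← Nat.card_eq_fintype_card, ← Submodule.cardQuot_apply, ← Ideal.absNorm_apply, 𝔭₃_asIdeal, absNorm_span_ϖ₃]
  set e := (ZMod.ringEquivOfPrime (𝓞 K ⧸ 𝔭₃.asIdeal) (by norm_num) hcard).symm with he
  refine ⟨e, ?_⟩
  have h0 : e (Ideal.Quotient.mk 𝔭₃.asIdeal ϖ₃) = 0 := by
    rw [Ideal.Quotient.eq_zero_iff_mem.mpr (by rw [𝔭₃_asIdeal]; exact Ideal.mem_span_singleton_self _), map_zero]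
  rw [ϖ₃, map_add, map_ofNat, map_add, map_ofNat] at h0
  generalize e (Ideal.Quotient.mk 𝔭₃.asIdeal sqrt7Int) = s at h0 ⊢
  revert s
  decide

/-- Any ring map `ψ : 𝓞 K → ℤ/3` with `ψ(√7) = 1` sends `ε′ ↦ 2`, `ϖ₃ ↦ 0`, `ϖ₄₇ ↦ 2`. [folklore] -/
theorem map_units_three (ψ : 𝓞 K →+* ZMod 3) (hψ : ψ sqrt7Int = 1) : ψ eps' = 2 ∧ ψ ϖ₃ = 0 ∧ ψ ϖ₄₇ = 2 := by
  simp only [eps', ϖ₃, ϖ₄₇, map_sub, map_add, map_mul, map_ofNat, hψ]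
  decide

/-- **`E₁ mod 𝔭₃ = [0, 2, 0, 0, 0]`**, the nodal cubic `y² = x²(x − 1)` over `𝔽₃` (`ā = 0`, `c̄ = 1`). [folklore] -/
theorem model_map_three (ψ : 𝓞 K →+* ZMod 3) (hψ : ψ sqrt7Int = 1) :
    (⟨0, -((ϖ₄₇ ^ 4) ^ 2 + -(eps' ^ 3 * ϖ₃) * ϖ₄₇ ^ 4), 0, -(eps' ^ 3 * ϖ₃) * (ϖ₄₇ ^ 4) ^ 3, 0⟩ : WeierstrassCurve (𝓞 K)).map ψ =
      ⟨0, 2, 0, 0, 0⟩ := by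
  obtain ⟨h1, h2, h3⟩ := map_units_three ψ hψ
  rw [model_map]
  simp only [map_pow, map_neg, map_mul, h1, h2, h3]
  ext <;> decide

/-- `c₄[0, 2, 0, 0, 0] ≠ 0` in `𝔽₃` (`c₄ = b₂² = 64 ≡ 1`). [folklore] -/
theorem c₄_three_ne_zero : (⟨0, 2, 0, 0, 0⟩ : WeierstrassCurve (ZMod 3)).c₄ ≠ 0 := by
  decide +kernel

/-- **`c₄(E₁) ∉ 𝔭₃`**. [folklore] -/
theorem model_c₄_not_mem_𝔭₃ :
    (⟨0, -((ϖ₄₇ ^ 4) ^ 2 + -(eps' ^ 3 * ϖ₃) * ϖ₄₇ ^ 4), 0, -(eps' ^ 3 * ϖ₃) * (ϖ₄₇ ^ 4) ^ 3, 0⟩ :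
      WeierstrassCurve (𝓞 K)).c₄ ∉ 𝔭₃.asIdeal := by
  obtain ⟨e, he⟩ := exists_ringEquiv_zmod_three
  have hψ : ((e : 𝓞 K ⧸ 𝔭₃.asIdeal →+* ZMod 3).comp (Ideal.Quotient.mk 𝔭₃.asIdeal)) sqrt7Int = 1 := he
  intro hmem
  apply c₄_three_ne_zero
  rw [← model_map_three _ hψ, map_c₄, RingHom.comp_apply, Ideal.Quotient.eq_zero_iff_mem.mpr hmem, map_zero]

/-- `v_{𝔭₃}(c₄(E₁ ⊗ K)) = 1` (a `𝔭₃`-unit). [folklore] -/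
theorem valuation_c₄_𝔭₃ : 𝔭₃.valuation K ((⟨0, -((ϖ₄₇ ^ 4) ^ 2 + -(eps' ^ 3 * ϖ₃) * ϖ₄₇ ^ 4), 0, -(eps' ^ 3 * ϖ₃) * (ϖ₄₇ ^ 4) ^ 3, 0⟩ :
      WeierstrassCurve (𝓞 K)).baseChange K).c₄ = 1 := by
  rw [baseChange, map_c₄, valuation_of_algebraMap]
  exact intValuation_eq_one_iff.mpr model_c₄_not_mem_𝔭₃

/-- `E₁ ⊗ K` written out: `[0, −(c²+ac), 0, ac³, 0]` with `a = −ε′³ϖ₃`, `c = ϖ₄₇⁴` in `K`. [folklore] -/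
theorem baseChange_model_eq : ((⟨0, -((ϖ₄₇ ^ 4) ^ 2 + -(eps' ^ 3 * ϖ₃) * ϖ₄₇ ^ 4), 0, -(eps' ^ 3 * ϖ₃) * (ϖ₄₇ ^ 4) ^ 3, 0⟩ :
      WeierstrassCurve (𝓞 K)).baseChange K) =
    ⟨0, -((((ϖ₄₇ : 𝓞 K) : K) ^ 4) ^ 2 + -(((eps' : 𝓞 K) : K) ^ 3 * ((ϖ₃ : 𝓞 K) : K)) * ((ϖ₄₇ : 𝓞 K) : K) ^ 4), 0,
      -(((eps' : 𝓞 K) : K) ^ 3 * ((ϖ₃ : 𝓞 K) : K)) * (((ϖ₄₇ : 𝓞 K) : K) ^ 4) ^ 3, 0⟩ := by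
  rw [baseChange, model_map]
  simp

/-- **`b = c − a = ε²ϖ₂³ϖ₃′¹²`** in `K`: `(3√7−4)⁴ + (8−3√7)³(2+√7) = (8+3√7)²(3+√7)³(√7−2)¹²` (Broberg's `a + b = c`).
[folklore] -/
theorem c_sub_a_eq : ((ϖ₄₇ : 𝓞 K) : K) ^ 4 - -(((eps' : 𝓞 K) : K) ^ 3 * ((ϖ₃ : 𝓞 K) : K)) =
    ((eps : 𝓞 K) : K) ^ 2 * ((ϖ₂ : 𝓞 K) : K) ^ 3 * ((ϖ₃' : 𝓞 K) : K) ^ 12 := by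
  rw [coe_eps, coe_eps', coe_ϖ₂, coe_ϖ₃, coe_ϖ₃', coe_ϖ₄₇]
  linear_combination (1010944 - 4297088 * sqrt7 + 7448656 * sqrt7 ^ 2 - 6216574 * sqrt7 ^ 3 + 1586326 * sqrt7 ^ 4
    + 1483502 * sqrt7 ^ 5 - 1359814 * sqrt7 ^ 6 + 261410 * sqrt7 ^ 7 + 167798 * sqrt7 ^ 8 - 95410 * sqrt7 ^ 9
    + 5642 * sqrt7 ^ 10 + 7826 * sqrt7 ^ 11 - 1986 * sqrt7 ^ 12 - 82 * sqrt7 ^ 13 + 87 * sqrt7 ^ 14 - 9 * sqrt7 ^ 15) * sqrt7_mul_sqrt7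

/-- `𝔭₃ ≠ 𝔭₂` (`2 ∉ 𝔭₃`). [folklore] -/
theorem 𝔭₃_ne_𝔭₂ : 𝔭₃ ≠ 𝔭₂ := by
  intro h
  have h2 : ((2 : ℕ) : 𝓞 K) ∉ 𝔭₃.asIdeal := natCast_not_mem_of_coprime 𝔭₃ natCast_three_mem_𝔭₃ (by norm_num)
  exact h2 (by rw [h, Nat.cast_ofNat]; exact two_mem_𝔭₂)

/-- `𝔭₃ ≠ 𝔭₄₇` (`47 ∉ 𝔭₃`). [folklore] -/
theorem 𝔭₃_ne_𝔭₄₇ : 𝔭₃ ≠ 𝔭₄₇ := by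
  intro h
  have h47 : ((47 : ℕ) : 𝓞 K) ∉ 𝔭₃.asIdeal := natCast_not_mem_of_coprime 𝔭₃ natCast_three_mem_𝔭₃ (by norm_num)
  exact h47 (by rw [h]; exact natCast_fortySeven_mem_𝔭₄₇)

/-- **`v_{𝔭₃}(Δ(E₁ ⊗ K)) = 𝔭₃^{−2}`**: `Δ = 16·a²·b²·c⁸` with `v_{𝔭₃}(a) = v_{𝔭₃}(ϖ₃) = 1`, and `16`, `b = ε²ϖ₂³ϖ₃′¹²`, `c = ϖ₄₇⁴` units
at `𝔭₃`. [folklore] -/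
theorem valuation_Δ_𝔭₃ : 𝔭₃.valuation K ((⟨0, -((ϖ₄₇ ^ 4) ^ 2 + -(eps' ^ 3 * ϖ₃) * ϖ₄₇ ^ 4), 0, -(eps' ^ 3 * ϖ₃) * (ϖ₄₇ ^ 4) ^ 3, 0⟩ :
      WeierstrassCurve (𝓞 K)).baseChange K).Δ = WithZero.exp (-2 : ℤ) := by
  rw [baseChange_model_eq, model_Δ, c_sub_a_eq]
  have hne := coe_ne_zero
  have ha : 𝔭₃.valuation K (-(((eps' : 𝓞 K) : K) ^ 3 * ((ϖ₃ : 𝓞 K) : K))) ≠ 0 :=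
    valuation_ne_zero_of_ne_zero 𝔭₃ (neg_ne_zero.mpr (mul_ne_zero (pow_ne_zero 3 hne.2.2.2.2.2.2) hne.1))
  have hb : 𝔭₃.valuation K (((eps : 𝓞 K) : K) ^ 2 * ((ϖ₂ : 𝓞 K) : K) ^ 3 * ((ϖ₃' : 𝓞 K) : K) ^ 12) ≠ 0 :=
    valuation_ne_zero_of_ne_zero 𝔭₃ (mul_ne_zero (mul_ne_zero (pow_ne_zero 2 hne.2.2.2.2.2.1) (pow_ne_zero 3 hne.2.2.2.2.1))
      (pow_ne_zero 12 hne.2.1))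
  have hc : 𝔭₃.valuation K (((ϖ₄₇ : 𝓞 K) : K) ^ 4) ≠ 0 := valuation_ne_zero_of_ne_zero 𝔭₃ (pow_ne_zero 4 hne.2.2.1)
  have h16 : 𝔭₃.valuation K (16 : K) ≠ 0 := valuation_ne_zero_of_ne_zero 𝔭₃ (by norm_num)
  have hlog16 : WithZero.log (𝔭₃.valuation K (16 : K)) = 0 := by
    have := log_valuation_natCast_of_coprime 𝔭₃ (n := 16) natCast_three_mem_𝔭₃ (by norm_num)
    rwa [Nat.cast_ofNat] at this
  have hloga : WithZero.log (𝔭₃.valuation K (-(((eps' : 𝓞 K) : K) ^ 3 * ((ϖ₃ : 𝓞 K) : K)))) = -1 := by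
    rw [Valuation.map_neg, map_mul, map_pow, WithZero.log_mul (pow_ne_zero 3 (valuation_ne_zero_of_ne_zero 𝔭₃ hne.2.2.2.2.2.2))
      (valuation_ne_zero_of_ne_zero 𝔭₃ hne.1), WithZero.log_pow, log_valuation_eps', log_valuation_ϖ₃, if_pos rfl]
    ring
  have hlogb : WithZero.log (𝔭₃.valuation K (((eps : 𝓞 K) : K) ^ 2 * ((ϖ₂ : 𝓞 K) : K) ^ 3 * ((ϖ₃' : 𝓞 K) : K) ^ 12)) = 0 := by
    rw [map_mul, map_mul, map_pow, map_pow, map_pow,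
      WithZero.log_mul (mul_ne_zero (pow_ne_zero 2 (valuation_ne_zero_of_ne_zero 𝔭₃ hne.2.2.2.2.2.1))
        (pow_ne_zero 3 (valuation_ne_zero_of_ne_zero 𝔭₃ hne.2.2.2.2.1))) (pow_ne_zero 12 (valuation_ne_zero_of_ne_zero 𝔭₃ hne.2.1)),
      WithZero.log_mul (pow_ne_zero 2 (valuation_ne_zero_of_ne_zero 𝔭₃ hne.2.2.2.2.2.1))
        (pow_ne_zero 3 (valuation_ne_zero_of_ne_zero 𝔭₃ hne.2.2.2.2.1)),
      WithZero.log_pow, WithZero.log_pow, WithZero.log_pow, log_valuation_eps, log_valuation_ϖ₂, log_valuation_ϖ₃',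
      if_neg 𝔭₃_ne_𝔭₂, if_neg 𝔭₃_ne_𝔭₃']
    ring
  have hlogc : WithZero.log (𝔭₃.valuation K (((ϖ₄₇ : 𝓞 K) : K) ^ 4)) = 0 := by
    rw [map_pow, WithZero.log_pow, log_valuation_ϖ₄₇, if_neg 𝔭₃_ne_𝔭₄₇]
    ring
  have hlog : WithZero.log (𝔭₃.valuation K (16 * (-(((eps' : 𝓞 K) : K) ^ 3 * ((ϖ₃ : 𝓞 K) : K))) ^ 2 *
      (((eps : 𝓞 K) : K) ^ 2 * ((ϖ₂ : 𝓞 K) : K) ^ 3 * ((ϖ₃' : 𝓞 K) : K) ^ 12) ^ 2 * (((ϖ₄₇ : 𝓞 K) : K) ^ 4) ^ 8)) = -2 := by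
    rw [map_mul, map_mul, map_mul, map_pow, map_pow, map_pow,
      WithZero.log_mul (mul_ne_zero (mul_ne_zero h16 (pow_ne_zero 2 ha)) (pow_ne_zero 2 hb)) (pow_ne_zero 8 hc),
      WithZero.log_mul (mul_ne_zero h16 (pow_ne_zero 2 ha)) (pow_ne_zero 2 hb), WithZero.log_mul h16 (pow_ne_zero 2 ha),
      WithZero.log_pow, WithZero.log_pow, WithZero.log_pow, hlog16, hloga, hlogb, hlogc]
    ring
  have hne0 : 𝔭₃.valuation K (16 * (-(((eps' : 𝓞 K) : K) ^ 3 * ((ϖ₃ : 𝓞 K) : K))) ^ 2 *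
      (((eps : 𝓞 K) : K) ^ 2 * ((ϖ₂ : 𝓞 K) : K) ^ 3 * ((ϖ₃' : 𝓞 K) : K) ^ 12) ^ 2 * (((ϖ₄₇ : 𝓞 K) : K) ^ 4) ^ 8) ≠ 0 := by
    rw [map_mul, map_mul, map_mul, map_pow, map_pow, map_pow]
    exact mul_ne_zero (mul_ne_zero (mul_ne_zero h16 (pow_ne_zero 2 ha)) (pow_ne_zero 2 hb)) (pow_ne_zero 8 hc)
  rw [← WithZero.exp_log hne0, hlog]

/-- **`E₁ ⊗ K` has MULTIPLICATIVE reduction at `𝔭₃`** (integral model, `c₄` a unit, `v(Δ) < 1`).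
[cite: SilvermanAEC2009, VII.5 Prop. 5.1(b)] -/
theorem hasMultiplicativeReductionAt_𝔭₃ : ((⟨0, -((ϖ₄₇ ^ 4) ^ 2 + -(eps' ^ 3 * ϖ₃) * ϖ₄₇ ^ 4), 0, -(eps' ^ 3 * ϖ₃) * (ϖ₄₇ ^ 4) ^ 3, 0⟩ :
      WeierstrassCurve (𝓞 K)).baseChange K).HasMultiplicativeReductionAt 𝔭₃ := by
  haveI := isElliptic_baseChange_of_Δ_not_mem (⟨0, -((ϖ₄₇ ^ 4) ^ 2 + -(eps' ^ 3 * ϖ₃) * ϖ₄₇ ^ 4), 0, -(eps' ^ 3 * ϖ₃) * (ϖ₄₇ ^ 4) ^ 3, 0⟩ :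
      WeierstrassCurve (𝓞 K))
    (placeOfSpan (3 + 2 * sqrt7Int) span_ϖ₁₉_isMaximal coe_ϖ₁₉_ne_zero) (model_Δ_not_mem _ rfl)
  refine hasMultiplicativeReductionAt_of_valuation_c₄_eq_one (isIntegralAt_baseChange (v := 𝔭₃) _) valuation_c₄_𝔭₃ ?_
  rw [valuation_Δ_𝔭₃, ← WithZero.exp_zero]
  exact WithZero.exp_lt_exp.mpr (by norm_num)

/-- **`ord_{𝔭₃}(Δ_min(E₁ ⊗ K)) = 2`** (the model is `𝔭₃`-integral with unit `c₄`, hence minimal at `𝔭₃`).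
[cite: SilvermanAEC2009, VII.1 Remark 1.1] -/
theorem ordMinimalDiscriminant_𝔭₃ : ((⟨0, -((ϖ₄₇ ^ 4) ^ 2 + -(eps' ^ 3 * ϖ₃) * ϖ₄₇ ^ 4), 0, -(eps' ^ 3 * ϖ₃) * (ϖ₄₇ ^ 4) ^ 3, 0⟩ :
      WeierstrassCurve (𝓞 K)).baseChange K).ordMinimalDiscriminant 𝔭₃ = 2 := by
  haveI := isElliptic_baseChange_of_Δ_not_mem (⟨0, -((ϖ₄₇ ^ 4) ^ 2 + -(eps' ^ 3 * ϖ₃) * ϖ₄₇ ^ 4), 0, -(eps' ^ 3 * ϖ₃) * (ϖ₄₇ ^ 4) ^ 3, 0⟩ :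
      WeierstrassCurve (𝓞 K))
    (placeOfSpan (3 + 2 * sqrt7Int) span_ϖ₁₉_isMaximal coe_ϖ₁₉_ne_zero) (model_Δ_not_mem _ rfl)
  have hmin := isMinimalAt_of_lt_valuation_c₄ (isIntegralAt_baseChange (v := 𝔭₃) (⟨0, -((ϖ₄₇ ^ 4) ^ 2 + -(eps' ^ 3 * ϖ₃) * ϖ₄₇ ^ 4), 0, -(eps' ^ 3 * ϖ₃) * (ϖ₄₇ ^ 4) ^ 3, 0⟩ :
      WeierstrassCurve (𝓞 K)))
    (by rw [valuation_c₄_𝔭₃, ← WithZero.exp_zero]; exact WithZero.exp_lt_exp.mpr (by norm_num))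
  have h1 := valuation_Δ_eq_of_isMinimalAt_holds 𝔭₃ _ hmin
  rw [valuation_Δ_𝔭₃, WithZero.exp_inj, neg_inj] at h1
  omega

/-! ## §4 `SL₂(𝔽_l) ⊆ Im(Γ_{ℚ(√7)})` on `E₁[l]`, on the Legendre model, and up to every theta-field -/

/-- `E₁ ⊗ K` is an elliptic curve over `K = ℚ(√7)`. [folklore] -/
theorem isElliptic_model : ((⟨0, -((ϖ₄₇ ^ 4) ^ 2 + -(eps' ^ 3 * ϖ₃) * ϖ₄₇ ^ 4), 0, -(eps' ^ 3 * ϖ₃) * (ϖ₄₇ ^ 4) ^ 3, 0⟩ :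
      WeierstrassCurve (𝓞 K)).baseChange K).IsElliptic :=
  isElliptic_baseChange_of_Δ_not_mem _ (placeOfSpan (3 + 2 * sqrt7Int) span_ϖ₁₉_isMaximal coe_ϖ₁₉_ne_zero)
    (model_Δ_not_mem _ rfl)

/-- **The image of `Γ_{ℚ(√7)}` in `Aut(E₁[l])` contains `SL₂(𝔽_l)`** for every prime `l ∤ 6` at which `E₁[l]` is irreducible:
irreducible plus the Tate-curve transvection at the multiplicative place `𝔭₃ ∌ l` with `l ∤ ord_{𝔭₃}(Δ_min) = 2` ([GenEll] Lem. 3.1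
(iii); tree `EllPoint.imageModLContainsSL2_of_not_admitsLCyclic_of_hasMultiplicativeReductionAt`). [cite: MochizukiGenEll2010, Lem 3.1 (iii) p.14] -/
theorem imageModLContainsSL2_model (l : ℕ) [Fact l.Prime] (h3 : Nat.Coprime l 3) (h2 : ¬ l ∣ 2)
    (hirr : ((⟨0, -((ϖ₄₇ ^ 4) ^ 2 + -(eps' ^ 3 * ϖ₃) * ϖ₄₇ ^ 4), 0, -(eps' ^ 3 * ϖ₃) * (ϖ₄₇ ^ 4) ^ 3, 0⟩ :
      WeierstrassCurve (𝓞 K)).baseChange K).HasIrreducibleModPGaloisRep l) :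
    (@EllPoint.mk K _ _ ((⟨0, -((ϖ₄₇ ^ 4) ^ 2 + -(eps' ^ 3 * ϖ₃) * ϖ₄₇ ^ 4), 0, -(eps' ^ 3 * ϖ₃) * (ϖ₄₇ ^ 4) ^ 3, 0⟩ :
      WeierstrassCurve (𝓞 K)).baseChange K) isElliptic_model).ImageModLContainsSL2 l := by
  haveI := isElliptic_model
  have hl : l.Prime := Fact.out
  haveI : NeZero (l : K) := ⟨by exact_mod_cast hl.ne_zero⟩
  set P : EllPoint := @EllPoint.mk K _ _ ((⟨0, -((ϖ₄₇ ^ 4) ^ 2 + -(eps' ^ 3 * ϖ₃) * ϖ₄₇ ^ 4), 0, -(eps' ^ 3 * ϖ₃) * (ϖ₄₇ ^ 4) ^ 3, 0⟩ :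
      WeierstrassCurve (𝓞 K)).baseChange K) isElliptic_model with hP
  have hno : ¬ P.AdmitsLCyclic l := fun hcyc =>
    (Mazur1978.not_hasIrreducibleModPGaloisRep_iff_exists_natCard_eq P.W l).mpr hcyc hirr
  exact P.imageModLContainsSL2_of_not_admitsLCyclic_of_hasMultiplicativeReductionAt l hno hasMultiplicativeReductionAt_𝔭₃
    (natCast_not_mem_of_coprime 𝔭₃ natCast_three_mem_𝔭₃ h3) (by rw [ordMinimalDiscriminant_𝔭₃]; exact h2)

/-- The Legendre equation `[0, −(1+λ), 0, λ, 0]` of Broberg's point is elliptic (`λ ≠ 0, 1`). [cite: SilvermanAEC2009, Prop. III.1.7] -/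
theorem isElliptic_legendre : (⟨0, -(1 + lam), 0, lam, 0⟩ : WeierstrassCurve K).IsElliptic :=
  (legendre_isElliptic_iff (F := K) two_ne_zero lam).2 point_inU

/-- `E₁ ⊗ K` rescaled by `u = c = ϖ₄₇⁴` is the Legendre equation of `λ = a/c`: `⟨c, 0, 0, 0⟩ • (E₁ ⊗ K) = [0, −(1+λ), 0, λ, 0]`.
[cite: SilvermanAEC2009, III.1 Table 3.1] -/
theorem rescale_model_eq_legendre :
    (⟨Units.mk0 (((ϖ₄₇ : 𝓞 K) : K) ^ 4) (pow_ne_zero 4 coe_ne_zero.2.2.1), 0, 0, 0⟩ : VariableChange K) • ((⟨0, -((ϖ₄₇ ^ 4) ^ 2 + -(eps' ^ 3 * ϖ₃) * ϖ₄₇ ^ 4), 0, -(eps' ^ 3 * ϖ₃) * (ϖ₄₇ ^ 4) ^ 3, 0⟩ :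
      WeierstrassCurve (𝓞 K)).baseChange K) =
      ⟨0, -(1 + lam), 0, lam, 0⟩ := by
  rw [baseChange_model_eq, model_rescale, lam_eq, neg_mul, neg_div]

/-- **The image of `Γ_{ℚ(√7)}` on the `l`-torsion of the Legendre curve `y² = x(x−1)(x−λ)` of Broberg's point contains
`SL₂(𝔽_l)`** whenever it does on `E₁[l]` (the two equations are `K`-isomorphic; tree `EllPoint.imageModLContainsSL2_of_variableChange_eq`).
[cite: Mochizuki2012, IUTchIV Cor. 2.2 (ii) (P6) p.46] -/
theorem imageModLContainsSL2_legendre (l : ℕ) [Fact l.Prime] (h3 : Nat.Coprime l 3) (h2 : ¬ l ∣ 2)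
    (hirr : ((⟨0, -((ϖ₄₇ ^ 4) ^ 2 + -(eps' ^ 3 * ϖ₃) * ϖ₄₇ ^ 4), 0, -(eps' ^ 3 * ϖ₃) * (ϖ₄₇ ^ 4) ^ 3, 0⟩ :
      WeierstrassCurve (𝓞 K)).baseChange K).HasIrreducibleModPGaloisRep l) :
    (@EllPoint.mk K _ _ (⟨0, -(1 + lam), 0, lam, 0⟩ : WeierstrassCurve K) isElliptic_legendre).ImageModLContainsSL2 l :=
  @EllPoint.imageModLContainsSL2_of_variableChange_eq K _ _ _ _ isElliptic_model isElliptic_legendre _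
    rescale_model_eq_legendre l _ (imageModLContainsSL2_model l h3 h2 hirr)

/-- **(P6) at Broberg's point from irreducibility over `ℚ(√7)`**: for a prime `l ∤ 6` with `l ∤ 46080 = 2¹⁰3²5` such that `E₁[l]`
is an irreducible `Γ_{ℚ(√7)}`-module, `Cor22.CondP6 Broberg.point l` holds: over `ℚ(√7)` the image contains `SL₂(𝔽_l)`
(`imageModLContainsSL2_legendre`), UP to every theta-field `F ⊇ ℚ(√7)` (Galois of degree dividing `46080`, prime to `l`) by
`EllPoint.imageModLContainsSL2_map_of_isGalois_of_not_dvd`, and the base-changed Legendre equation IS `Cor22.thetaCurve Broberg.point F`.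
[cite: Mochizuki2012, IUTchIV Cor. 2.2 (ii) (P6) p.46] -/
theorem condP6_of_irreducible (l : ℕ) [Fact l.Prime] (h3 : Nat.Coprime l 3) (h2 : ¬ l ∣ 2) (h46080 : ¬ l ∣ 46080)
    (hirr : ((⟨0, -((ϖ₄₇ ^ 4) ^ 2 + -(eps' ^ 3 * ϖ₃) * ϖ₄₇ ^ 4), 0, -(eps' ^ 3 * ϖ₃) * (ϖ₄₇ ^ 4) ^ 3, 0⟩ :
      WeierstrassCurve (𝓞 K)).baseChange K).HasIrreducibleModPGaloisRep l) :
    Cor22.CondP6 point l := by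
  intro hU F _ _ iA hF _
  have hdeg : ¬ l ∣ Module.finrank point.F F := fun h => h46080 (h.trans hF.finrank_dvd)
  have hup := @EllPoint.imageModLContainsSL2_map_of_isGalois_of_not_dvd
    (@EllPoint.mk K _ _ (⟨0, -(1 + lam), 0, lam, 0⟩ : WeierstrassCurve K) isElliptic_legendre) F _ _ iA l _ hF.isGalois hdeg
    (imageModLContainsSL2_legendre l h3 h2 hirr)
  have hW : (1 : VariableChange F) • ((⟨0, -(1 + lam), 0, lam, 0⟩ : WeierstrassCurve K).map (@algebraMap K F _ _ iA)) =
      Cor22.thetaCurve point F := by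
    rw [one_smul]
    ext <;> simp only [WeierstrassCurve.map, map_zero, map_neg, map_add, map_one] <;> rfl
  exact @EllPoint.imageModLContainsSL2_of_variableChange_eq F _ _ _ _ (_) (Cor22.thetaCurve_isElliptic hU F) 1 hW l _ hup

/-! ## §5 (P6) and non-emptiness at `(Broberg.point, 7)` and `(Broberg.point, 11)` -/

/-- **(P6) HOLDS at `(Broberg.point, 7)`**: for every theta-field `F = ℚ(√7)(√−1, E_λ[15])` the image of `Gal(F̄/F)` on `E_λ[7]`
contains `SL₂(𝔽₇)` — the Frobenius certificate at `𝔮 = (3 + 2√7)`. Row 9 («pilotDataOfK:broberg-Q7:7») of the R-W table.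
[cite: Mochizuki2012, IUTchIV Cor. 2.2 (ii) (P6) p.46] -/
theorem condP6_seven : Cor22.CondP6 point 7 :=
  haveI : Fact (Nat.Prime 7) := ⟨by norm_num⟩
  condP6_of_irreducible 7 (by norm_num) (by norm_num) (by norm_num)
    (hasIrreducibleModPGaloisRep_seven (placeOfSpan (3 + 2 * sqrt7Int) span_ϖ₁₉_isMaximal coe_ϖ₁₉_ne_zero) rfl)

/-- **(P6) HOLDS at `(Broberg.point, 11)`** — row 10 («pilotDataOfK:broberg-Q7:11»). [cite: Mochizuki2012, IUTchIV Cor. 2.2 (ii) (P6) p.46] -/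
theorem condP6_eleven : Cor22.CondP6 point 11 :=
  haveI : Fact (Nat.Prime 11) := ⟨by norm_num⟩
  condP6_of_irreducible 11 (by norm_num) (by norm_num) (by norm_num)
    (hasIrreducibleModPGaloisRep_eleven (placeOfSpan (3 + 2 * sqrt7Int) span_ϖ₁₉_isMaximal coe_ϖ₁₉_ne_zero) rfl)

/-- **Row 9 is NON-VACUOUS UNCONDITIONALLY: `Cor22.ThetaVolumeDatumAt Broberg.point 7` is inhabited** (admissibility `BrobergAdmissible`
+ (P6) `condP6_seven`, through the route's proved `ThetaPartII.stub_thetaData`). [cite: Mochizuki2012, IUTchIV Cor. 2.2 (ii) proof (P7) p.46] -/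
theorem nonempty_thetaVolumeDatumAt_seven : Nonempty (Cor22.ThetaVolumeDatumAt point 7) :=
  nonempty_thetaVolumeDatumAt_seven_of_condP6 condP6_seven

/-- **Row 10 is NON-VACUOUS UNCONDITIONALLY: `Cor22.ThetaVolumeDatumAt Broberg.point 11` is inhabited.**
[cite: Mochizuki2012, IUTchIV Cor. 2.2 (ii) proof (P7) p.46] -/
theorem nonempty_thetaVolumeDatumAt_eleven : Nonempty (Cor22.ThetaVolumeDatumAt point 11) :=
  nonempty_thetaVolumeDatumAt_eleven_of_condP6 condP6_eleven

end Summit.ABC.IUTFork.Broberg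

end
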